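import Summits.Ventures.HSemireg.WedgeHankelCoSiegelTower
import Summits.Ventures.HSemireg.WedgeHankelSubstitutionSiegel
import Summits.Ventures.HSemireg.WedgeHankelPairMixingSiegel
import Summits.Ventures.HSemireg.WedgeHankelPairMixingDet

/-!
# Venture HSemireg — THE CO-SIEGEL TOWER IS STABLE UNDER THE MONOID `M₂(K) × M_n(K)`: every substitution of the letters (singular included) maps `coSiegel(j)` into `coSiegel(j)` for EVERY
# `j`; invertible ones map it ONTO itself; every pair mixing maps it into itself, and a SINGULAR pair mixing kills the whole tower above the bottom (`j ≥ n`)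

HONEST FRAMING. Part of the Lean index of the computation cell `pub-hsemireg` (seat p10 gen 19, Sunday typer «UNIFORM-IN-n»).
Finite-dimensional EXTERIOR ALGEBRA over a field ONLY: no variety, no cohomology theory, no sheaf, no Ext group, no semiregularity map;
nothing here says that HC / HC_CM / HC_AV holds; no Literature fact is declared or used.  Custodian versions as in `WedgeHankelSiegelIdeal` (1/3); the dictionary (the co-Siegel forms =
`θ ∧ (classes)`) is QUOTED, never asserted.

WHAT IS IN THE TREE.  G6 `WedgeHankelCoSiegelTower`: `coSiegel_eq_bot_of_lt` (`j < n`), `coSiegel_n_eq_span_w` (degree `n` = th-7's classes), **`Hom_mul_coSiegel_n`: `coSiegel(k′ + n) =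
Hom(univ, k′) * coSiegel(n)`** (`k′ ≤ n`), `coSiegel_le_Hom`; H1 `Sb_w`; H1b `Sb_mem_exteriorPower`, `SbE`; I3 (946) `Pm_mem_exteriorPower`; H9b `Pm_w_eq_det_smul`, `PmE`; already typed:
`SI_k` (H1b / I3), `Kr`, `V` (H1b / H9b / I5) under the monoid.  THIS FILE completes the atlas statement for the co-Siegel tower (namespace `Summit.Ventures.HSemireg.Wedge.KernelDuality`
continued):
* §206 **`Sb_mem_coSiegel`: `θ ∈ coSiegel(j) ⇒ Sb g θ ∈ coSiegel(j)` for EVERY substitution `g` and EVERY `j`** (`j < n`: `⊥`; `j = n + k′`: `Hom(k′)·classes`, `Sb` is an algebra map keeping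
  degrees and classes); `map_Sb_coSiegel_le`; **`map_SbE_coSiegel`: equality for `det g ≠ 0`** (dimension count).
* §207 **`Pm_mem_coSiegel`: `θ ∈ coSiegel(j) ⇒ Pm M θ ∈ coSiegel(j)` for EVERY `M`**; `map_PmE_coSiegel` (equality, `det M ≠ 0`); **`Pm_eq_zero_of_mem_coSiegel`: for `det M = 0` and `j ≥ n`,
  `Pm M` KILLS `coSiegel(j)`** (every co-Siegel form of degree `≥ n` is a sum of `η ∧ w_n(q)` and `Pm M (w_n q) = det M · w_n q = 0`).
NOT typed here: `coSiegel(j)` for `j < n` is `⊥` anyway; the image of a singular `Sb` on the tower (the multiples of the pure class of the image letter, cf. I12); anything Ext-side.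
New names only.
-/

open Module

namespace Summit.Ventures.HSemireg.Wedge.KernelDuality

open Summit.Ventures.HSemireg.Wedge Summit.Ventures.HSemireg.Wedge.Kunneth Summit.Ventures.HSemireg.Wedge.Hankel
  Summit.Ventures.HSemireg.Wedge.KunnethKernel Summit.Ventures.HSemireg.Wedge.HankelFrameChange Summit.Ventures.HSemireg.Wedge.HankelPairMixing
  Summit.Ventures.HSemireg.Wedge.HankelSiegel Summit.Ventures.HSemireg.Wedge.HankelSiegelIdeal

variable (K : Type*) [Field K] {n : ℕ}

/-! ## §206. Substitutions of the letters on the co-Siegel tower -/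

/-- `Sb g` maps `Hom(univ, k′) · coSiegel(n)` into itself (degrees are kept, classes go to classes). -/
theorem map_Sb_Hom_mul_coSiegel_le (α β γ δ : K) (k' : ℕ) :
    (Hom K (In n) Finset.univ k' * coSiegel K n n).map (Sb K (n := n) α β γ δ).toLinearMap ≤ Hom K (In n) Finset.univ k' * coSiegel K n n := by
  rw [Submodule.map_mul]
  refine mul_le_mul' ?_ ?_
  · rintro _ ⟨η, hη, rfl⟩
    rw [SetLike.mem_coe, Hom_univ_eq_exteriorPower] at hη
    rw [AlgHom.toLinearMap_apply, Hom_univ_eq_exteriorPower]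
    exact Sb_mem_exteriorPower K α β γ δ hη
  · rintro _ ⟨θ, hθ, rfl⟩
    rw [SetLike.mem_coe, coSiegel_n_eq_span_w] at hθ
    rw [AlgHom.toLinearMap_apply]
    induction hθ using Submodule.span_induction with
    | mem x hx => obtain ⟨q, rfl⟩ := hx; rw [Sb_w K α β γ δ le_rfl]; exact w_mem_coSiegel K _
    | zero => rw [map_zero]; exact Submodule.zero_mem _
    | add x y _ _ hx hy => rw [map_add]; exact Submodule.add_mem _ hx hy
    | smul c x _ hx => rw [map_smul]; exact Submodule.smul_mem _ _ hx

/-- **EVERY SUBSTITUTION MAPS EVERY CO-SIEGEL SPACE INTO ITSELF: `θ ∈ coSiegel(j) ⇒ Sb g θ ∈ coSiegel(j)`** (every `g`, singular included; every `j`). -/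
theorem Sb_mem_coSiegel (α β γ δ : K) {j : ℕ} {θ : HT K (In n)} (hθ : θ ∈ coSiegel K n j) : Sb K α β γ δ θ ∈ coSiegel K n j := by
  by_cases hj : j < n
  · rw [coSiegel_eq_bot_of_lt K hj] at hθ ⊢
    rw [(Submodule.mem_bot K).mp hθ, map_zero]; exact Submodule.zero_mem _
  · by_cases hjn : j ≤ n + n
    · have e : j = (j - n) + n := by omega
      rw [e, ← Hom_mul_coSiegel_n K (show j - n ≤ n by omega)] at hθ ⊢
      exact map_Sb_Hom_mul_coSiegel_le K α β γ δ (j - n) ⟨θ, hθ, rfl⟩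
    · -- above the top degree the space is `0`
      have h0 : θ ∈ Hom K (In n) Finset.univ j := coSiegel_le_Hom K j hθ
      rw [Hom_univ_eq_exteriorPower] at h0
      have hb : (⋀[K]^j (In n → K) : Submodule K (HT K (In n))) = ⊥ := by
        refine Submodule.finrank_eq_zero.mp ?_
        rw [exteriorPower.finrank_eq, finrank_fintype_fun_eq_card, Fintype.card_fin, Nat.choose_eq_zero_of_lt (by omega)]
      rw [hb, Submodule.mem_bot] at h0
      rw [h0, map_zero]; exact Submodule.zero_mem _

/-- submodule form: `Sb g (coSiegel(j)) ≤ coSiegel(j)`. -/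
theorem map_Sb_coSiegel_le (α β γ δ : K) (j : ℕ) : (coSiegel K n j).map (Sb K (n := n) α β γ δ).toLinearMap ≤ coSiegel K n j := by
  rintro _ ⟨θ, hθ, rfl⟩; exact Sb_mem_coSiegel K α β γ δ hθ

/-- **an INVERTIBLE substitution maps every co-Siegel space ONTO itself: `SbE (coSiegel(j)) = coSiegel(j)`.** -/
theorem map_SbE_coSiegel {α β γ δ : K} (h : α * δ - β * γ ≠ 0) (j : ℕ) : (coSiegel K n j).map (SbE K (n := n) h).toLinearMap = coSiegel K n j :=
  Submodule.eq_of_le_of_finrank_eq (map_Sb_coSiegel_le K α β γ δ j) ((SbE K (n := n) h).toLinearEquiv.finrank_map_eq _)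

/-! ## §207. Pair mixings on the co-Siegel tower -/

/-- `Pm M` maps `Hom(univ, k′) · coSiegel(n)` into itself (classes are scaled by `det M`). -/
theorem map_Pm_Hom_mul_coSiegel_le (M : Matrix (Fin n) (Fin n) K) (k' : ℕ) :
    (Hom K (In n) Finset.univ k' * coSiegel K n n).map (Pm K (n := n) M).toLinearMap ≤ Hom K (In n) Finset.univ k' * coSiegel K n n := by
  rw [Submodule.map_mul]
  refine mul_le_mul' ?_ ?_
  · rintro _ ⟨η, hη, rfl⟩
    rw [SetLike.mem_coe, Hom_univ_eq_exteriorPower] at hη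
    rw [AlgHom.toLinearMap_apply, Hom_univ_eq_exteriorPower]
    exact Pm_mem_exteriorPower K M hη
  · rintro _ ⟨θ, hθ, rfl⟩
    rw [SetLike.mem_coe, coSiegel_n_eq_span_w] at hθ
    rw [AlgHom.toLinearMap_apply]
    induction hθ using Submodule.span_induction with
    | mem x hx => obtain ⟨q, rfl⟩ := hx; rw [Pm_w_eq_det_smul]; exact Submodule.smul_mem _ _ (w_mem_coSiegel K _)
    | zero => rw [map_zero]; exact Submodule.zero_mem _
    | add x y _ _ hx hy => rw [map_add]; exact Submodule.add_mem _ hx hy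
    | smul c x _ hx => rw [map_smul]; exact Submodule.smul_mem _ _ hx

/-- **EVERY PAIR MIXING MAPS EVERY CO-SIEGEL SPACE INTO ITSELF: `θ ∈ coSiegel(j) ⇒ Pm M θ ∈ coSiegel(j)`** (every `M`, every `j`). -/
theorem Pm_mem_coSiegel (M : Matrix (Fin n) (Fin n) K) {j : ℕ} {θ : HT K (In n)} (hθ : θ ∈ coSiegel K n j) : Pm K M θ ∈ coSiegel K n j := by
  by_cases hj : j < n
  · rw [coSiegel_eq_bot_of_lt K hj] at hθ ⊢
    rw [(Submodule.mem_bot K).mp hθ, map_zero]; exact Submodule.zero_mem _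
  · by_cases hjn : j ≤ n + n
    · have e : j = (j - n) + n := by omega
      rw [e, ← Hom_mul_coSiegel_n K (show j - n ≤ n by omega)] at hθ ⊢
      exact map_Pm_Hom_mul_coSiegel_le K M (j - n) ⟨θ, hθ, rfl⟩
    · have h0 : θ ∈ Hom K (In n) Finset.univ j := coSiegel_le_Hom K j hθ
      rw [Hom_univ_eq_exteriorPower] at h0
      have hb : (⋀[K]^j (In n → K) : Submodule K (HT K (In n))) = ⊥ := by
        refine Submodule.finrank_eq_zero.mp ?_
        rw [exteriorPower.finrank_eq, finrank_fintype_fun_eq_card, Fintype.card_fin, Nat.choose_eq_zero_of_lt (by omega)]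
      rw [hb, Submodule.mem_bot] at h0
      rw [h0, map_zero]; exact Submodule.zero_mem _

/-- submodule form. -/
theorem map_Pm_coSiegel_le (M : Matrix (Fin n) (Fin n) K) (j : ℕ) : (coSiegel K n j).map (Pm K (n := n) M).toLinearMap ≤ coSiegel K n j := by
  rintro _ ⟨θ, hθ, rfl⟩; exact Pm_mem_coSiegel K M hθ

/-- **an invertible pair mixing maps every co-Siegel space ONTO itself.** -/
theorem map_PmE_coSiegel {M : Matrix (Fin n) (Fin n) K} (hM : M.det ≠ 0) (j : ℕ) : (coSiegel K n j).map (PmE K (n := n) hM).toLinearMap = coSiegel K n j :=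
  Submodule.eq_of_le_of_finrank_eq (map_Pm_coSiegel_le K M j) ((PmE K (n := n) hM).toLinearEquiv.finrank_map_eq _)

/-- **A SINGULAR PAIR MIXING KILLS THE WHOLE CO-SIEGEL TOWER: `det M = 0 ⇒ Pm M θ = 0` for every `θ ∈ coSiegel(j)`, every `j`** (below `n` the space is `0`; from `n` on every form is a sum of
`η ∧ w_n(q)` and `Pm M (w_n q) = det M · w_n q = 0`). -/
theorem Pm_eq_zero_of_mem_coSiegel {M : Matrix (Fin n) (Fin n) K} (hM : M.det = 0) {j : ℕ} {θ : HT K (In n)} (hθ : θ ∈ coSiegel K n j) : Pm K M θ = 0 := by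
  by_cases hj : j < n
  · rw [coSiegel_eq_bot_of_lt K hj] at hθ
    rw [(Submodule.mem_bot K).mp hθ, map_zero]
  · by_cases hjn : j ≤ n + n
    · have e : j = (j - n) + n := by omega
      rw [e, ← Hom_mul_coSiegel_n K (show j - n ≤ n by omega)] at hθ
      refine Submodule.mul_induction_on hθ (fun η _ θ' hθ' => ?_) (fun x y hx hy => by rw [map_add, hx, hy, add_zero])
      rw [coSiegel_n_eq_span_w] at hθ'
      rw [map_mul]
      suffices h : Pm K M θ' = 0 by rw [h, mul_zero]
      induction hθ' using Submodule.span_induction with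
      | mem x hx => obtain ⟨q, rfl⟩ := hx; rw [Pm_w_eq_det_smul, hM, zero_smul]
      | zero => rw [map_zero]
      | add x y _ _ hx hy => rw [map_add, hx, hy, add_zero]
      | smul c x _ hx => rw [map_smul, hx, smul_zero]
    · have h0 : θ ∈ Hom K (In n) Finset.univ j := coSiegel_le_Hom K j hθ
      rw [Hom_univ_eq_exteriorPower] at h0
      have hb : (⋀[K]^j (In n → K) : Submodule K (HT K (In n))) = ⊥ := by
        refine Submodule.finrank_eq_zero.mp ?_
        rw [exteriorPower.finrank_eq, finrank_fintype_fun_eq_card, Fintype.card_fin, Nat.choose_eq_zero_of_lt (by omega)]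
      rw [hb, Submodule.mem_bot] at h0
      rw [h0, map_zero]

/-- hence for `det M = 0` the image of every co-Siegel space is `0`. -/
theorem map_Pm_coSiegel_eq_bot_of_det_eq_zero {M : Matrix (Fin n) (Fin n) K} (hM : M.det = 0) (j : ℕ) : (coSiegel K n j).map (Pm K (n := n) M).toLinearMap = ⊥ := by
  rw [Submodule.eq_bot_iff]
  rintro _ ⟨θ, hθ, rfl⟩
  exact Pm_eq_zero_of_mem_coSiegel K hM hθ

end Summit.Ventures.HSemireg.Wedge.KernelDuality
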